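import Summits.Ventures.CertifiedManyBodySolver.Observables.PairLROTowerChargedOpNorm
import Summits.Ventures.CertifiedManyBodySolver.Observables.PairLROTowerChargedNumber
import Summits.Ventures.CertifiedManyBodySolver.Observables.RungLeavesPairAnchor
import Literature.MathematicalPhysics.QuantumLattice.FermionEmbedLocality
import HarnessLib

/-!
# OP1-C, part 7: the READING step — the space-group-averaged CHARGED equation-of-motion term, the
# orbit-state form of the grid theorem, and the summit-format leaf at any anchor

HONEST FRAMING: first certified bounds on pairing observables; not a superconductivity verdict; a ceiling route,
never presence; nothing in this file is a number. Crew hubbard-obs (D-0042), seat hubbard-obs-p1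
(`prover-hubbard-obs-p1-g9-0`); lead RULINGS (eo) d181 / (es) d185 / (ex) d190. Zero compute; no definition; no
named fact; no `sorry`.

The OP1-C claim nodes (Stage B cell certificates of sr-mbsolver-menu-3 on the B0-class gauge-broken one-point
object, registry row 24) will be typed — like the OP1-E / OP1-S nodes — in ORBIT-STATE form over the space-group
family `(U_w D_γ)_{w ∈ (ℤ/L)², γ ∈ S}`: the certificate identity read in `ω̄_ζ` for every unit `ζ`, now carrying
the CHARGED equation-of-motion term `Re ω̄_ζ(K_L Γ_L X − Γ_L X K_L)`, `K_L = H_L − μ'N̂` at the cell's GRID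
chemical potential `μ'`, `X ∈ 𝔄_{Λ'}` the multiplier-weighted combination of the certificate's charged eom
generators (`X`, `Xᴴ` even). This file supplies the dictionary to the plain form consumed by the grid theorem
`liminf_pairFieldLRO_le_sq_of_onePoint_chargedStationary_bound_TT'_near` (PairLROTowerChargedBracket):

* `orbitState_spaceGroupUnitary_commutator_fermionEmbed_of_invariant` — for any `D₄`- and translation-invariant
  torus operator `K` (e.g. `H_L − μ'N̂`): `ω̄_ζ([K, Γ_L X]) = |S|⁻¹ Σ_{γ∈S} L⁻² ⟨ζ, [K, W_γ] ζ⟩`, `W_γ` the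
  translation sum of the rotated word;
* **`liminf_pairFieldLRO_le_sq_of_onePoint_chargedStationary_orbitState_bound_TT'_near`** — OP1-C in
  orbit-state form at a grid point: point group `S ≠ ∅` fixing the form factor, `μ_c ∈ [μ₋(n), μ₊(n)]` with
  `|μ' − μ_c| ≤ Δ`, and the LOCAL operator-norm charge bound `‖N̂₀X − XN̂₀‖ ≤ C_q` (producer convention (a),
  PairLROTowerChargedOpNorm) ⇒ `liminf_k u_k ≤ (c − Δ·C_q − A + (Σμ_σ)(n/2 − ν))²`. The symmetrised word
  `X_S = |S|⁻¹ Σ_γ Γ(incl)Γ(d4Emb γ)X` is even with even adjoint (`fermionEmbed_mem_carEvenSubalgebra`), its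
  `N̂` double commutators are `O(L²)` by PairLROTowerChargedNumber (ANY even word), and
  `‖N̂_Ω X_S − X_S N̂_Ω‖ ≤ C_q` (`Γ` intertwines the charge and is contractive);
* the registry consumers (`ObsPairLROCeilingAt_of_onePoint_charged_orbitState_bound_sq` + `_reprice` + the M3
  corollary: a D₂-type OP1-C node with cap `e₀ ≤ hi ≤ u` ⇒ `ObsPairLROCeilingAt tp U n c'` at every
  `c' ≥ (c − Δ·C_q − A + (Σμ)(n/2 − ν))²`) follow in PairLROTowerChargedLeaf.

CONDITIONAL on the claim node fed in and on the cell datum `μ_c ∈ [μ₋(n), μ₊(n)]`, `|μ' − μ_c| ≤ Δ` (boxed by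
certified chords, `chemPot_mem_cell_of_mem_Icc`; the cover over cells is hubbard-obs-lit's CELLS file).
References: T. Koma, H. Tasaki, J. Stat. Phys. 76 (1994) 745, Theorem 5 [KomaTasaki1994]; O. Bratteli,
D. W. Robinson, *Operator Algebras and Quantum Statistical Mechanics 2* (1997), §5.2.2, §6.2.4
[BratteliRobinsonII1997]; W. Pusz, S. L. Woronowicz, Comm. Math. Phys. 58 (1978) 273, §1 [PuszWoronowicz1978];
D. Ruelle, *Statistical Mechanics* (1969) §3.4 [Ruelle1969].
-/

noncomputable section

namespace Summit.Ventures.CertifiedManyBodySolver.Observables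

open Matrix Complex Finset Literature.MathematicalPhysics.QuantumLattice Literature.Probability.LatticeModels
open Literature.MathematicalPhysics.QuantumLattice.HubbardWave0 ThermodynamicLimit Filter Topology
open Literature.MathematicalPhysics.QuantumManyBody.StateRelaxation
open Summit.Ventures.CertifiedManyBodySolver.Transport
open scoped ComplexOrder ComplexConjugate BigOperators Matrix.Norms.L2Operator

/-! ### §1  The space-group average of a CHARGED equation-of-motion term -/

section Reading

variable {L : ℕ} [NeZero L]

/-- `expect` is additive over finite sums. [folklore] -/
private theorem expect_finset_sum'' {ι κ : Type*} [LinearOrder ι] [Fintype ι] (s : Finset κ)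
    (f : κ → Matrix (Finset ι) (Finset ι) ℂ) (ψ : Fock ι) :
    expect (∑ k ∈ s, f k) ψ = ∑ k ∈ s, expect (f k) ψ := by
  unfold Literature.MathematicalPhysics.QuantumLattice.expect
  rw [Matrix.sum_mulVec, dotProduct_sum]

/-- **The space-group-averaged orbit state of a commutator with an INVARIANT torus operator.** For a finite
`S ⊆ D₄`, a window `Λ'` fitting into the torus, `X ∈ 𝔄_{Λ'}`, a torus operator `K` invariant under the point
group and the translations (`K = H_L − μ'N̂` : `relabel_d4Perm_hubbardTorusTT'`, `relabel_mapEquiv_totalNumber`)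
and any torus vector `ζ`:
`ω̄_ζ(K Γ_L X − Γ_L X K) = |S|⁻¹ Σ_{γ∈S} L⁻² ⟨ζ, (K W_γ − W_γ K) ζ⟩`, `W_γ = Σ_v T_v Γ_{L,γΛ'}(Γ(d4Emb γ 0 Λ') X)`.
[cite: BratteliRobinsonII1997, §6.2.4] -/
theorem orbitState_spaceGroupUnitary_commutator_fermionEmbed_of_invariant (S : Finset (DihedralGroup 4))
    (K : Matrix (Finset (Orb (FermionTorus 2 L))) (Finset (Orb (FermionTorus 2 L))) ℂ)
    (hKD : ∀ γ : DihedralGroup 4, relabel (Orb.d4Perm (L := L) γ) K = K)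
    (hKT : ∀ v : TorusSite 2 L, relabel (Orb.translate v) K = K)
    {Λ' : Finset (Site 2)} (hInj' : Set.InjOn (Torus.proj (d := 2) L) ↑Λ') (X : FermionOp Λ')
    (ζ : Fock (Orb (FermionTorus 2 L))) :
    orbitState (spaceGroupUnitary S) ζ
        (K * fermionEmbed (PolySite.toTorusEmb L hInj') X - fermionEmbed (PolySite.toTorusEmb L hInj') X * K) =
      (S.card : ℂ)⁻¹ * ∑ γ ∈ S, ((Fintype.card (TorusSite 2 L) : ℂ))⁻¹ *
        expect (K *
            (∑ v : TorusSite 2 L, relabel (Orb.translate v)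
              (fermionEmbed (PolySite.toTorusEmb L ((injOn_proj_d4ShiftSet_iff L γ 0 Λ').2 hInj'))
                (fermionEmbed (PolySite.d4Emb γ 0 Λ') X))) -
          (∑ v : TorusSite 2 L, relabel (Orb.translate v)
              (fermionEmbed (PolySite.toTorusEmb L ((injOn_proj_d4ShiftSet_iff L γ 0 Λ').2 hInj'))
                (fermionEmbed (PolySite.d4Emb γ 0 Λ') X))) * K) ζ := by
  set Y := fermionEmbed (PolySite.toTorusEmb L hInj') X with hY
  rw [orbitState_spaceGroupUnitary_eq_sum_expect_conj S]
  refine congrArg _ (Finset.sum_congr rfl fun γ _ => ?_)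
  refine congrArg _ ?_
  have hInjγ : Set.InjOn (Torus.proj (d := 2) L) ↑(d4ShiftSet γ 0 Λ') :=
    (injOn_proj_d4ShiftSet_iff L γ 0 Λ').2 hInj'
  set D := (fockD4 (L := L) γ).val with hD
  set Yγ := fermionEmbed (PolySite.toTorusEmb L hInjγ) (fermionEmbed (PolySite.d4Emb γ 0 Λ') X) with hYγ
  -- `D (·) Dᴴ = relabel (d4Perm γ)`, an algebra homomorphism fixing `K` and rotating `Y` to `Y_γ`
  have hrel : ∀ A : Matrix (Finset (Orb (FermionTorus 2 L))) (Finset (Orb (FermionTorus 2 L))) ℂ,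
      D * A * Dᴴ = relabel (Orb.d4Perm (L := L) γ) A := fun A => by
    rw [relabel_eq_fockRelabel_conj, hD, fockD4_apply]
  have hDY : relabel (Orb.d4Perm (L := L) γ) Y = Yγ := by
    have hproj0 : Torus.proj L (0 : Site 2) = 0 := by
      funext i
      simp [Torus.proj]
    rw [hYγ, fermionEmbed_toTorusEmb_d4Emb γ 0 hInj' hInjγ X, hproj0, Orb.translate_zero, Equiv.Perm.one_def,
      relabel_refl, hY]
  have hconj : D * (K * Y - Y * K) * Dᴴ = K * Yγ - Yγ * K := by
    rw [hrel, relabel_sub, relabel_mul, relabel_mul, hKD γ, hDY]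
  simp_rw [hconj]
  -- the translation average of `[K, Y_γ]` is `⟨ζ, [K, Σ_v T_v Y_γ] ζ⟩`
  have hstep : ∀ v : TorusSite 2 L, expect (K * Yγ - Yγ * K) ((fockTranslate v).val *ᵥ ζ) =
      expect (K * relabel (Orb.translate (-v)) Yγ - relabel (Orb.translate (-v)) Yγ * K) ζ := by
    intro v
    rw [expect_fockRelabel_mulVec, ← Equiv.Perm.inv_def, ← Orb.translate_neg, relabel_sub, relabel_mul,
      relabel_mul, hKT]
  simp_rw [hstep]
  rw [← expect_finset_sum'']
  congr 1
  rw [Finset.mul_sum, Finset.sum_mul, ← Finset.sum_sub_distrib]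
  exact Fintype.sum_equiv (Equiv.neg (TorusSite 2 L)) _ _ fun v => rfl

/-- `K_L = H_L − μ'N̂` is `D₄`-invariant. [cite: BratteliRobinsonII1997, §5.2.2] -/
theorem relabel_d4Perm_hubbardTorusTT'_sub_smul_totalNumber (γ : DihedralGroup 4) (t t' U : ℝ) (μ' : ℂ) :
    relabel (Orb.d4Perm (L := L) γ) (hubbardTorusTT' L t t' U - μ' • totalNumber) =
      hubbardTorusTT' L t t' U - μ' • totalNumber := by
  rw [relabel_sub, relabel_smul, relabel_d4Perm_hubbardTorusTT', Orb.d4Perm_eq_mapEquiv, relabel_mapEquiv_totalNumber]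

/-- `K_L = H_L − μ'N̂` is translation invariant. [cite: BratteliRobinsonII1997, §5.2.2] -/
theorem relabel_translate_hubbardTorusTT'_sub_smul_totalNumber (v : TorusSite 2 L) (t t' U : ℝ) (μ' : ℂ) :
    relabel (Orb.translate v) (hubbardTorusTT' L t t' U - μ' • totalNumber) =
      hubbardTorusTT' L t t' U - μ' • totalNumber := by
  rw [relabel_sub, relabel_smul, relabel_translate_hubbardTorusTT', Orb.translate, relabel_mapEquiv_totalNumber]

end Reading

/-! ### §2  The symmetrised charged word: evenness and its operator-norm charge -/

section Symmetrised

variable {Λ' Ω : Finset (Site 2)} (S : Finset (DihedralGroup 4))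

/-- **The symmetrised word is even** when `X` is: `Γ(incl)Γ(d4Emb γ)X ∈ 𝔄⁺_Ω` for every `γ`, hence their mean.
[cite: BratteliRobinsonII1997, §5.2.2] -/
theorem spaceGroupAverage_mem_carEvenSubalgebra (hsub : ∀ γ ∈ S, d4ShiftSet γ 0 Λ' ⊆ Ω) {X : FermionOp Λ'}
    (hX : X ∈ carEvenSubalgebra (Finset.univ : Finset (Orb (PolySite Λ')))) (a : ℂ) :
    (a • ∑ γ ∈ S.attach, fermionEmbed (PolySite.incl (hsub γ.1 γ.2)) (fermionEmbed (PolySite.d4Emb γ.1 0 Λ') X) :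
        FermionOp Ω) ∈ carEvenSubalgebra (Finset.univ : Finset (Orb (PolySite Ω))) := by
  refine Subalgebra.smul_mem _ (Subalgebra.sum_mem _ fun γ _ => ?_) _
  exact carEvenSubalgebra_mono (Finset.subset_univ _) (fermionEmbed_mem_carEvenSubalgebra _
    (carEvenSubalgebra_mono (Finset.subset_univ _) (fermionEmbed_mem_carEvenSubalgebra _ hX)))

/-- The adjoint of the symmetrised word is the symmetrised adjoint. [folklore] -/
theorem conjTranspose_spaceGroupAverage (hsub : ∀ γ ∈ S, d4ShiftSet γ 0 Λ' ⊆ Ω) (X : FermionOp Λ') (a : ℂ) :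
    (a • ∑ γ ∈ S.attach, fermionEmbed (PolySite.incl (hsub γ.1 γ.2)) (fermionEmbed (PolySite.d4Emb γ.1 0 Λ') X) :
        FermionOp Ω)ᴴ =
      star a • ∑ γ ∈ S.attach, fermionEmbed (PolySite.incl (hsub γ.1 γ.2)) (fermionEmbed (PolySite.d4Emb γ.1 0 Λ') Xᴴ) := by
  rw [conjTranspose_smul, conjTranspose_sum]
  refine congrArg _ (Finset.sum_congr rfl fun γ _ => ?_)
  rw [← fermionEmbed_conjTranspose, ← fermionEmbed_conjTranspose]

/-- **The operator-norm charge of the symmetrised word is that of `X`**: `Γ` intertwines the charge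
(`totalNumberOp_commutator_fermionEmbed`) and is contractive (`norm_fermionEmbed_le`), so
`‖N̂_Ω X_S − X_S N̂_Ω‖ ≤ ‖N̂_{Λ'} X − X N̂_{Λ'}‖` for `X_S = |S|⁻¹ Σ_{γ∈S} Γ(incl)Γ(d4Emb γ)X`.
[cite: BratteliRobinsonII1997, §5.2.2] -/
theorem norm_totalNumberOp_commutator_spaceGroupAverage_le (hS : S.Nonempty)
    (hsub : ∀ γ ∈ S, d4ShiftSet γ 0 Λ' ⊆ Ω) (X : FermionOp Λ') :
    ‖(totalNumberOp : FermionOp Ω) *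
        (((S.card : ℂ))⁻¹ • ∑ γ ∈ S.attach,
          fermionEmbed (PolySite.incl (hsub γ.1 γ.2)) (fermionEmbed (PolySite.d4Emb γ.1 0 Λ') X)) -
      (((S.card : ℂ))⁻¹ • ∑ γ ∈ S.attach,
          fermionEmbed (PolySite.incl (hsub γ.1 γ.2)) (fermionEmbed (PolySite.d4Emb γ.1 0 Λ') X)) * totalNumberOp‖ ≤
      ‖(totalNumberOp : FermionOp Λ') * X - X * totalNumberOp‖ := by
  have hcardpos : (0 : ℝ) < (S.card : ℝ) := Nat.cast_pos.2 (Finset.card_pos.2 hS)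
  have hcomm : (totalNumberOp : FermionOp Ω) *
        (((S.card : ℂ))⁻¹ • ∑ γ ∈ S.attach,
          fermionEmbed (PolySite.incl (hsub γ.1 γ.2)) (fermionEmbed (PolySite.d4Emb γ.1 0 Λ') X)) -
      (((S.card : ℂ))⁻¹ • ∑ γ ∈ S.attach,
          fermionEmbed (PolySite.incl (hsub γ.1 γ.2)) (fermionEmbed (PolySite.d4Emb γ.1 0 Λ') X)) * totalNumberOp =
      ((S.card : ℂ))⁻¹ • ∑ γ ∈ S.attach, fermionEmbed (PolySite.incl (hsub γ.1 γ.2))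
        (fermionEmbed (PolySite.d4Emb γ.1 0 Λ') ((totalNumberOp : FermionOp Λ') * X - X * totalNumberOp)) := by
    rw [Matrix.mul_smul, Matrix.smul_mul, ← smul_sub, Finset.mul_sum, Finset.sum_mul, ← Finset.sum_sub_distrib]
    refine congrArg _ (Finset.sum_congr rfl fun γ _ => ?_)
    rw [totalNumberOp_commutator_fermionEmbed, totalNumberOp_commutator_fermionEmbed]
  rw [hcomm, norm_smul, norm_inv, Complex.norm_natCast]
  calc (S.card : ℝ)⁻¹ * ‖∑ γ ∈ S.attach, fermionEmbed (PolySite.incl (hsub γ.1 γ.2))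
        (fermionEmbed (PolySite.d4Emb γ.1 0 Λ') ((totalNumberOp : FermionOp Λ') * X - X * totalNumberOp))‖
      ≤ (S.card : ℝ)⁻¹ * ∑ _γ ∈ S.attach, ‖(totalNumberOp : FermionOp Λ') * X - X * totalNumberOp‖ := by
        refine mul_le_mul_of_nonneg_left ((norm_sum_le _ _).trans (Finset.sum_le_sum fun γ _ => ?_))
          (inv_nonneg.2 hcardpos.le)
        exact (norm_fermionEmbed_le _ _).trans (norm_fermionEmbed_le _ _)
    _ = ‖(totalNumberOp : FermionOp Λ') * X - X * totalNumberOp‖ := by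
        rw [Finset.sum_const, Finset.card_attach, nsmul_eq_mul, ← mul_assoc, inv_mul_cancel₀ hcardpos.ne', one_mul]

end Symmetrised

/-! ### §3  (OP1-C) in orbit-state form at a grid point ⇒ `liminf u_k ≤ (M + Δ·C_q)²` -/

section Family

variable (g : Site 2 → ℝ)

/-- **Orbit-state form of OP1-C at a grid chemical potential, sharp constant.** Let `U ≥ 0`, `0 < n < 2`,
`κ ≥ 0`, `e(t,t',U,n) ≤ u`, `μ_c ∈ [μ₋(n), μ₊(n)]` with `|μ' − μ_c| ≤ Δ`, `S ≠ ∅` a point group fixing the form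
factor `g` on `{0,±e₁,±e₂}`, `Λ' ⊇ pairRegion {0,±e₁,±e₂} 0` a window fitting the tori of side `≥ L₁`, and
`X ∈ 𝔄_{Λ'}` a word with `X`, `Xᴴ` even and LOCAL charge bound `‖N̂_{Λ'}X − XN̂_{Λ'}‖ ≤ C_q` (the producer's
`Σ_X |λ_X|·|q_X|·B_X`). Suppose (OP1-C, orbit-state form): for every `L ≥ L₁` and unit `ζ`,
`c − A + Σ_σ μ_σ(Re⟨ζ,N_σζ⟩/L² − ν) + κ(u − Re⟨ζ,H_Lζ⟩/L²) + Re ω̄_ζ(K_L Γ_L X − Γ_L X K_L) ≤ Re ω̄_ζ(Γ_L(−Γ(incl)Φ₀^g))`,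
`K_L = H_L − μ'N̂`, `ω̄_ζ = orbitState (spaceGroupUnitary S) ζ`. Then every family of unit
`(rectN n L, S^z=0)`-sector ground states has `liminf_k u_k ≤ (c − Δ·C_q − A + (Σ_σ μ_σ)(n/2 − ν))²`.
[cite: KomaTasaki1994, Theorem 5] [cite: PuszWoronowicz1978, §1] [cite: BratteliRobinsonII1997, §6.2.4]
[cite: Ruelle1969, §3.4] -/
theorem liminf_pairFieldLRO_le_sq_of_onePoint_chargedStationary_orbitState_bound_TT'_near (t t' : ℝ)
    {U n : ℝ} (hU : 0 ≤ U) (hn0 : 0 < n) (hn2 : n < 2) {c A κ u ν : ℝ} (μ : Fin 2 → ℝ) (hκ : 0 ≤ κ)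
    (hu : energyDensityTT' t t' U n ≤ u) {μc μ' Δ Cq : ℝ}
    (hμc : μc ∈ Set.Icc (chemPotMinusTT' t t' U n) (chemPotPlusTT' t t' U n)) (hnear : |μ' - μc| ≤ Δ)
    {S : Finset (DihedralGroup 4)} (hS : S.Nonempty)
    (hg : ∀ γ ∈ S, ∀ e ∈ insert (0 : Site 2) unitSteps, g (d4Vec γ e) = g e)
    {Λ' : Finset (Site 2)} (h0 : pairRegion (insert (0 : Site 2) unitSteps) 0 ⊆ Λ')
    (X : FermionOp Λ') (hXeven : X ∈ carEvenSubalgebra (Finset.univ : Finset (Orb (PolySite Λ'))))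
    (hXevenH : Xᴴ ∈ carEvenSubalgebra (Finset.univ : Finset (Orb (PolySite Λ'))))
    (hXq : ‖(totalNumberOp : FermionOp Λ') * X - X * totalNumberOp‖ ≤ Cq) (L₁ : ℕ)
    (hInj : ∀ L : ℕ, L₁ ≤ L → Set.InjOn (Torus.proj (d := 2) L) ↑Λ')
    (hbound : ∀ (L : ℕ) [NeZero L] (hL : L₁ ≤ L) (ζ : Fock (Orb (FermionTorus 2 L))), star ζ ⬝ᵥ ζ = 1 →
      c - A + ∑ σ : Fin 2, μ σ *
          ((star ζ ⬝ᵥ ((∑ y : FermionTorus 2 L, numberOp y σ) *ᵥ ζ)).re / (L : ℝ) ^ 2 - ν) +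
        κ * (u - (star ζ ⬝ᵥ (hubbardTorusTT' L t t' U *ᵥ ζ)).re / (L : ℝ) ^ 2) +
        (orbitState (spaceGroupUnitary S) ζ
          ((hubbardTorusTT' L t t' U - (μ' : ℂ) • totalNumber) * fermionEmbed (PolySite.toTorusEmb L (hInj L hL)) X -
            fermionEmbed (PolySite.toTorusEmb L (hInj L hL)) X *
              (hubbardTorusTT' L t t' U - (μ' : ℂ) • totalNumber))).re ≤
        (orbitState (spaceGroupUnitary S) ζ (fermionEmbed (PolySite.toTorusEmb L (hInj L hL))
          (-(fermionEmbed (PolySite.incl h0) (localPairAt (insert (0 : Site 2) unitSteps) g 0))))).re)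
    (ψ : ∀ L, Fock (Orb (FermionTorus 2 L)))
    (hψ : ∀ L, IsGroundStateInSector (hubbardTorusTT' L t t' U) (rectN n L) 0 (ψ L))
    (hψ1 : ∀ L, star (ψ L) ⬝ᵥ ψ L = 1) :
    liminf (fun k : ℕ => (∑ x ∈ halfOpenBox 2 (2 * k), ∑ y ∈ halfOpenBox 2 (2 * k),
        torusPullback (pairFieldCorr g ψ) (2 * k) x y) / ((#(halfOpenBox 2 (2 * k)) : ℝ)) ^ 2) atTop ≤
      (c - Δ * Cq - A + (∑ σ : Fin 2, μ σ) * (n / 2 - ν)) ^ 2 := by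
  -- the symmetrised eom word on `Ω = ⋃_γ γΛ'`
  set Ω : Finset (Site 2) := S.biUnion (fun γ => d4ShiftSet γ 0 Λ') with hΩdef
  have hsub : ∀ γ ∈ S, d4ShiftSet γ 0 Λ' ⊆ Ω := fun γ hγ =>
    Finset.subset_biUnion_of_mem (fun γ => d4ShiftSet γ 0 Λ') hγ
  set XS : FermionOp Ω := ((S.card : ℂ))⁻¹ •
    ∑ γ ∈ S.attach, fermionEmbed (PolySite.incl (hsub γ.1 γ.2)) (fermionEmbed (PolySite.d4Emb γ.1 0 Λ') X)
    with hXS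
  have hXSeven : XS ∈ carEvenSubalgebra (Finset.univ : Finset (Orb (PolySite Ω))) :=
    spaceGroupAverage_mem_carEvenSubalgebra S hsub hXeven _
  have hXSevenH : XSᴴ ∈ carEvenSubalgebra (Finset.univ : Finset (Orb (PolySite Ω))) := by
    rw [hXS, conjTranspose_spaceGroupAverage S hsub X]
    exact spaceGroupAverage_mem_carEvenSubalgebra S hsub hXevenH _
  have hXSq : ‖(totalNumberOp : FermionOp Ω) * XS - XS * totalNumberOp‖ ≤ Cq :=
    (norm_totalNumberOp_commutator_spaceGroupAverage_le S hS hsub X).trans hXq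
  obtain ⟨DN, LN, hDN, hDD₁, hDD₂⟩ := exists_abs_re_doubleCommutator_totalNumber_le_hermitianParts XS hXSeven hXSevenH
  obtain ⟨LΩ, hLΩ⟩ := exists_forall_le_injOn_proj (d := 2) Ω
  have hInjΩ : ∀ L : ℕ, max L₁ LΩ ≤ L → Set.InjOn (Torus.proj (d := 2) L) ↑Ω :=
    fun L hL => hLΩ L (le_trans (le_max_right _ _) hL)
  refine liminf_pairFieldLRO_le_sq_of_onePoint_chargedStationary_bound_TT'_near g t t' hU hn0 hn2 μ hκ hu hμc
    hnear XS hXSeven hXSevenH (max L₁ LΩ) hInjΩ LN hDN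
    (fun L _ hL hLN χ hχ => hDD₁ L hLN (hInjΩ L hL) χ hχ)
    (fun L _ hL hLN χ hχ => hDD₂ L hLN (hInjΩ L hL) χ hχ) ?_ ?_ ψ hψ hψ1
  · -- `hWq` in operator-norm form
    intro L _ hL ζ hζ
    exact (abs_re_expect_totalNumber_commutator_translationSum_le_opNorm (hInjΩ L hL) XS ζ hζ).trans
      (mul_le_mul_of_nonneg_right hXSq (by positivity))
  · -- the node: the averaged charged eom term is the plain charged eom term of the translation sum of `XS`
    intro L _ hL ζ hζ
    have hL₁ : L₁ ≤ L := le_trans (le_max_left _ _) hL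
    have hcardS : (S.card : ℂ) ≠ 0 := Nat.cast_ne_zero.2 (Finset.card_pos.2 hS).ne'
    have hcardT : (Fintype.card (TorusSite 2 L) : ℂ) = (((L : ℝ) ^ 2 : ℝ) : ℂ) := by
      have hc : Fintype.card (TorusSite 2 L) = L ^ 2 := by simp [ZMod.card, Fintype.card_fin]
      rw [hc]; push_cast; ring
    set K : Matrix (Finset (Orb (FermionTorus 2 L))) (Finset (Orb (FermionTorus 2 L))) ℂ :=
      hubbardTorusTT' L t t' U - (μ' : ℂ) • totalNumber with hK
    have hKD : ∀ γ : DihedralGroup 4, relabel (Orb.d4Perm (L := L) γ) K = K := fun γ =>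
      relabel_d4Perm_hubbardTorusTT'_sub_smul_totalNumber γ t t' U _
    have hKT : ∀ v : TorusSite 2 L, relabel (Orb.translate v) K = K := fun v =>
      relabel_translate_hubbardTorusTT'_sub_smul_totalNumber v t t' U _
    have hW : ∑ v : TorusSite 2 L, relabel (Orb.translate v) (fermionEmbed (PolySite.toTorusEmb L (hInjΩ L hL)) XS) =
        ((S.card : ℂ))⁻¹ • ∑ γ ∈ S, (∑ v : TorusSite 2 L, relabel (Orb.translate v)
          (fermionEmbed (PolySite.toTorusEmb L ((injOn_proj_d4ShiftSet_iff L γ 0 Λ').2 (hInj L hL₁)))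
            (fermionEmbed (PolySite.d4Emb γ 0 Λ') X))) := by
      rw [sum_translate_spaceGroupAverage_eq S (hInj L hL₁) (hInjΩ L hL) hsub X, hXS]
      simp_rw [fermionEmbed_smul, relabel_smul]
      rw [← Finset.smul_sum]
    have hsumexp : ∑ γ ∈ S, expect (K *
        (∑ v : TorusSite 2 L, relabel (Orb.translate v)
          (fermionEmbed (PolySite.toTorusEmb L ((injOn_proj_d4ShiftSet_iff L γ 0 Λ').2 (hInj L hL₁)))
            (fermionEmbed (PolySite.d4Emb γ 0 Λ') X))) -
        (∑ v : TorusSite 2 L, relabel (Orb.translate v)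
          (fermionEmbed (PolySite.toTorusEmb L ((injOn_proj_d4ShiftSet_iff L γ 0 Λ').2 (hInj L hL₁)))
            (fermionEmbed (PolySite.d4Emb γ 0 Λ') X))) * K) ζ =
        (S.card : ℂ) * expect (K *
          (∑ v : TorusSite 2 L, relabel (Orb.translate v) (fermionEmbed (PolySite.toTorusEmb L (hInjΩ L hL)) XS)) -
          (∑ v : TorusSite 2 L, relabel (Orb.translate v) (fermionEmbed (PolySite.toTorusEmb L (hInjΩ L hL)) XS)) *
            K) ζ := by
      rw [hW, Matrix.mul_smul, Matrix.smul_mul, ← smul_sub, Finset.mul_sum, Finset.sum_mul, ← Finset.sum_sub_distrib]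
      unfold Literature.MathematicalPhysics.QuantumLattice.expect
      rw [smul_mulVec, dotProduct_smul, smul_eq_mul, ← mul_assoc, mul_inv_cancel₀ hcardS, one_mul,
        Matrix.sum_mulVec, dotProduct_sum]
    have heom : (orbitState (spaceGroupUnitary S) ζ
        (K * fermionEmbed (PolySite.toTorusEmb L (hInj L hL₁)) X -
          fermionEmbed (PolySite.toTorusEmb L (hInj L hL₁)) X * K)).re =
        (star ζ ⬝ᵥ ((K *
          (∑ v : TorusSite 2 L, relabel (Orb.translate v) (fermionEmbed (PolySite.toTorusEmb L (hInjΩ L hL)) XS)) -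
          (∑ v : TorusSite 2 L, relabel (Orb.translate v) (fermionEmbed (PolySite.toTorusEmb L (hInjΩ L hL)) XS)) *
            K) *ᵥ ζ)).re / (L : ℝ) ^ 2 := by
      rw [orbitState_spaceGroupUnitary_commutator_fermionEmbed_of_invariant S K hKD hKT (hInj L hL₁) X ζ,
        ← Finset.mul_sum, hsumexp, mul_left_comm, inv_mul_cancel_left₀ hcardS, hcardT, ← Complex.ofReal_inv,
        Complex.re_ofReal_mul, inv_mul_eq_div]
      rfl
    have h := hbound L hL₁ ζ hζ
    rw [fermionEmbed_neg, map_neg, Complex.neg_re,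
      re_orbitState_spaceGroupUnitary_localPairAt g hS hg h0 (hInj L hL₁) ζ, heom] at h
    exact h

end Family

end Summit.Ventures.CertifiedManyBodySolver.Observables

end
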